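import Summits.Langlands.Langlands.Theorems.SoloInformedRepairR3plus
import Literature.NumberTheory.PAdicHodge.BmaxPlusLog
import Literature.NumberTheory.PAdicHodge.BmaxPlusTDivP
import Mathlib.RingTheory.Localization.Away.Basic
import Mathlib.LinearAlgebra.TensorProduct.Tower
import Mathlib.LinearAlgebra.Matrix.Charpoly.Basic
import HarnessLib
import HarnessLib.Audit.Tags

/-!
# Repair D2-cris, typed over the CONSTRUCTED ring `B_max(K_v) = A_max[1/t]`: "crystalline, with the
# Satake Frobenius, at unramified `v ∣ ℓ`" (Buzzard–Gee Conj. 3.2.2, last clause + its `φ`-half)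

Summit `Langlands`.  Context: `Theorems/SoloInformedRepairR3plus` (re-scoping R3⁺: Satake a.e.,
`WD_v(ρ)^{F-ss} ≅ rec_v(π_v)` at `v ∤ ℓ`, de Rham + labelled Hodge–Tate weights at `v ∣ ℓ`; every clause
a statement about constructed objects) and `Theorems/SoloInformedPinExclusionSpec` (the summit's own
`v ∣ ℓ` conjunct reads Hilbert's `ε` over a specification with disjoint models).  R3⁺ DROPS two printed
clauses of Buzzard–Gee 3.2.2 at `p`: the Hodge type `WD(D_pst(ρ|Γ_{K_v}))` (needs `B_st`, `D_pst`,
linearisation — absent from the tree) and "if `π_v` is unramified then `ρ|Γ_{K_v}` is crystalline".  This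
file RESTORES the second, with the Frobenius half of the first at those places, over a period ring the
tree now constructs — so, like R3⁺ and unlike `Langlands`, without any pinned datum:
* `Bmax F p := Localization.Away tBmax` = `A_max(F)[1/t]` for the tree's `A_max = BmaxPlus F p` and
  Fontaine's `t ∈ A_max` (`PAdicHodge/BmaxPlusLog`).  As `t = p·t'` (`exists_tBmax_eq_natCast_mul`,
  `PAdicHodge/BmaxPlusTDivP`), `p` is a unit, so this IS `B_max⁺[1/t] = B_max`; `φ` (`φ t = p t`) and
  `Γ_F` (`σ t = χ(σ) t`) extend by the universal property (`frobBmax`, `galBmax`), commute, and are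
  `ℚ_p`-linear for `ℚ_p = Frac ℤ_p → A_max[1/t]` (`qpToBmax`; `φ`, `σ` fix `ℤ_p ⊆ 𝔸_inf`).
* `Dcris ρ_v := (ℚ̄_p^m ⊗_{ℚ_p} B_max(F))^{Γ_F}` (diagonal action) for a framed `ρ_v : Γ_F → GL_m(ℚ̄_p)`,
  a `ℚ̄_p`-subspace with `φ_D = (1 ⊗ φ)|_D` (`phiDcris`).  Neither `K₀ ↪ B_max` nor `B_max^Γ = K₀` nor
  regularity is used or claimed.
* `CrystallineCompatibleAt ι π ρ v hv` (`v ∣ ℓ`): for every Satake parameter `α` of `π` at `v`,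
  `D = Dcris (ρ|Γ_{K_v})` has a `ℚ̄_ℓ`-basis of size `n·f` (`f = f(v|ℓ) = v.asIdeal.inertiaDeg ℤ`) with
  `charpoly (φ_D^f) = (∏_{a ∈ α} (X - ι⁻¹ a))^f`.  Size `n·f` IS crystallinity (`dim_{K_{v,0}} D_cris = n`,
  `[K_{v,0} : ℚ_ℓ] = f`; `B_max`- and `B_cris`-admissibility coincide, Colmez).  `φ^f` is
  `K_{v,0} ⊗ ℚ̄_ℓ`-linear and `φ` permutes the `f` pieces `D_τ` (`τ : K_{v,0} ↪ ℚ̄_ℓ`), which therefore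
  share one characteristic polynomial `P`, and `charpoly_{ℚ̄_ℓ}(φ^f | D) = P^f`; the `τ`-free form
  needs no `K_{v,0} ↪ B_max` and is equivalent to the `τ`-wise one by unique factorisation.
  `P = ∏ (X - ι⁻¹ a)`: Fontaine's `WD(D_cris)(Frob_geom) = φ^f` against the summit's own normalisation
  (`SatakeFrobCompatibleAt`: ARITHMETIC Frobenius has `charpoly = ∏ (X - (ι⁻¹ a)⁻¹)`,
  `arithFrobPolyOfSatake ι q 1 α`; `geomFrobPolyOfSatake_eq`); check on `|·| ↔ ε_ℓ`: `α = q⁻¹`,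
  `D_cris(ℚ_ℓ(1)) = K_{v,0}·t⁻¹`, `φ^f = q⁻¹`.
* `CorrespondsD2Cris := CorrespondsR3plus ∧ ∀ v ∣ ℓ, CrystallineCompatibleAt`; (A), (B), conjunction and
  `@[conjecture] LanglandsD2Cris` in the summit's quantifier shape VERBATIM (the added conjunct takes
  no reciprocity datum `𝓡`); `LanglandsD2Cris → LanglandsR3plus` given Deligne–Serre uniqueness
  (`langlandsR3plus_of_langlandsD2Cris`; the tree proves that uniqueness unconditionally,
  `SoloBlind.isConjugate_of_eventually`, not imported here).
Beyond R3⁺, D2-cris asserts crystallinity and the Frobenius eigenvalues at every `v ∣ ℓ` with `π_v`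
unramified.  Still DROPPED relative to Buzzard–Gee 3.2.2: the Weil–Deligne type at RAMIFIED `v ∣ ℓ`
(definition item D2 proper).  A Theorems-side shadow for the operator's decision; the Statement is
operator-owned and unchanged.
-/

noncomputable section

open scoped MatrixGroups Matrix Classical Polynomial NumberField TensorProduct
open NumberField IsDedekindDomain Field Polynomial Filter
open Literature.NumberTheory.Automorphic Literature.NumberTheory.GaloisRepresentations
open Literature.NumberTheory.PAdicHodge

namespace Summit.Langlands.Langlands.Theorems

namespace D2Cris

/-! ### §1 `D = (E^m ⊗_{ℚ_p} B)^Γ` and `φ_D` for an abstract `ℚ_p`-algebra `B` with `φ` and a family `Γ` of automorphisms -/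

section Abstract

variable {p : ℕ} [Fact p.Prime] {E : Type*} [Field E] [Algebra ℚ_[p] E]
  {Γ : Type*} {B : Type*} [CommRing B] [Algebra ℚ_[p] B] {m : ℕ}

/-- The diagonal action `ρ(σ) ⊗ σ_B` of `σ ∈ Γ` on `E^m ⊗_{ℚ_p} B` (`E`-linear: `Γ` acts on `B` by
`ℚ_p`-algebra maps). [cite: FontaineAsterisque223III, Exp. III §1.3] -/
def diagAct (ρ : Γ → GL (Fin m) E) (gal : Γ → (B →ₐ[ℚ_[p]] B)) (σ : Γ) :
    (Fin m → E) ⊗[ℚ_[p]] B →ₗ[E] (Fin m → E) ⊗[ℚ_[p]] B :=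
  TensorProduct.AlgebraTensorModule.map
    (Matrix.toLin' ((ρ σ : GL (Fin m) E) : Matrix (Fin m) (Fin m) E)) (gal σ).toLinearMap

/-- **`D(ρ) := (E^m ⊗_{ℚ_p} B)^Γ`**, the `E`-subspace of invariants of the diagonal action (Fontaine's
`D_B(V) = (B ⊗ V)^{G_K}` with coefficients; `ρ`, `gal` are plain maps — only the fixed vectors of the
family matter). [cite: FontaineAsterisque223III, Exp. III §1.3] -/
def invariants (ρ : Γ → GL (Fin m) E) (gal : Γ → (B →ₐ[ℚ_[p]] B)) :
    Submodule E ((Fin m → E) ⊗[ℚ_[p]] B) where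
  carrier := {x | ∀ σ : Γ, diagAct ρ gal σ x = x}
  add_mem' {a b} ha hb σ := by rw [map_add, ha σ, hb σ]
  zero_mem' σ := map_zero _
  smul_mem' c {x} hx σ := by rw [map_smul, hx σ]

/-- `1 ⊗ φ` on `E^m ⊗_{ℚ_p} B`. [cite: FontaineAsterisque223III, Exp. III §1.3] -/
def phiTensor (φ : B →ₐ[ℚ_[p]] B) : (Fin m → E) ⊗[ℚ_[p]] B →ₗ[E] (Fin m → E) ⊗[ℚ_[p]] B :=
  TensorProduct.AlgebraTensorModule.map LinearMap.id φ.toLinearMap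

/-- `1 ⊗ φ` commutes with the diagonal action when `φ` commutes with `Γ` on `B`. [folklore] -/
theorem diagAct_comp_phiTensor (ρ : Γ → GL (Fin m) E) (gal : Γ → (B →ₐ[ℚ_[p]] B))
    (φ : B →ₐ[ℚ_[p]] B) (hφ : ∀ σ, (gal σ).comp φ = φ.comp (gal σ)) (σ : Γ) :
    diagAct ρ gal σ ∘ₗ phiTensor (E := E) φ = phiTensor φ ∘ₗ diagAct ρ gal σ := by
  refine TensorProduct.AlgebraTensorModule.ext fun v b => ?_
  simp only [LinearMap.comp_apply, phiTensor, diagAct, TensorProduct.AlgebraTensorModule.map_tmul,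
    LinearMap.id_apply, AlgHom.toLinearMap_apply]
  rw [← AlgHom.comp_apply, hφ, AlgHom.comp_apply]

/-- **`φ_D := (1 ⊗ φ)|_{D(ρ)}`** (`E`-linear). [cite: FontaineAsterisque223III, Exp. III §1.3] -/
def phiD (ρ : Γ → GL (Fin m) E) (gal : Γ → (B →ₐ[ℚ_[p]] B)) (φ : B →ₐ[ℚ_[p]] B)
    (hφ : ∀ σ, (gal σ).comp φ = φ.comp (gal σ)) : invariants ρ gal →ₗ[E] invariants ρ gal :=
  (phiTensor φ).restrict fun x (hx : ∀ σ, diagAct ρ gal σ x = x) (σ : Γ) => by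
    have h := LinearMap.congr_fun (diagAct_comp_phiTensor ρ gal φ hφ σ) x
    simp only [LinearMap.comp_apply] at h
    rw [h, hx σ]

end Abstract

/-! ### §2 The constructed ring `B_max(F) = A_max[1/t]` with `φ`, `Γ_F` and its `ℚ_p`-structure -/

section Bmax

variable {F : Type} [Field F] [ValuativeRel F] [TopologicalSpace F] [IsNonarchimedeanLocalField F]
  [CharZero F] {p : ℕ} [Fact p.Prime] [Fact (¬ IsUnit (p : integerC F))]
  [IsAdicComplete (Ideal.span {(p : integerC F)}) (integerC F)]

variable (F p) in
/-- **`B_max(F) := A_max(F)[1/t]`** (localisation of the tree's `A_max = BmaxPlus F p` away from Fontaine's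
`t`; `= B_max⁺[1/t] = B_max` as `p ∣ t`); a `def`, so the type does not mention `t`. [cite: Colmez1998Annals, §III.2] -/
def Bmax : Type := Localization.Away (tBmax (F := F) (p := p))

/-- Ring structure of `A_max[1/t]` (Mathlib `Localization`). [folklore] -/
instance instCommRingBmax : CommRing (Bmax F p) :=
  inferInstanceAs (CommRing (Localization.Away (tBmax (F := F) (p := p))))

/-- `A_max`-algebra structure of `A_max[1/t]` (Mathlib `Localization`). [folklore] -/
instance instAlgebraBmax : Algebra (BmaxPlus F p) (Bmax F p) :=
  inferInstanceAs (Algebra (BmaxPlus F p) (Localization.Away (tBmax (F := F) (p := p))))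

/-- `A_max[1/t]` is the localisation away from `t` (Mathlib `Localization.isLocalization`). [folklore] -/
instance instIsLocalizationBmax : IsLocalization.Away (tBmax (F := F) (p := p)) (Bmax F p) :=
  inferInstanceAs (IsLocalization.Away (tBmax (F := F) (p := p))
    (Localization.Away (tBmax (F := F) (p := p))))

/-- `t` is a unit of `A_max[1/t]`. [folklore] -/
theorem isUnit_algebraMap_tBmax : IsUnit (algebraMap (BmaxPlus F p) (Bmax F p) tBmax) :=
  IsLocalization.Away.algebraMap_isUnit _

/-- **`p` is a unit of `A_max[1/t]`** (`t = p·t'`). [cite: Colmez1998Annals, §III.2] -/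
theorem isUnit_natCast_bmax : IsUnit ((p : ℕ) : Bmax F p) := by
  obtain ⟨t', ht'⟩ := exists_tBmax_eq_natCast_mul (F := F) (p := p)
  have h := congrArg (algebraMap (BmaxPlus F p) (Bmax F p)) ht'
  rw [map_mul, map_natCast] at h
  have hu := isUnit_algebraMap_tBmax (F := F) (p := p)
  rw [h] at hu
  exact isUnit_of_mul_isUnit_left hu

/-- `φ t = p·t` is a unit of `A_max[1/t]`. [folklore] -/
theorem isUnit_frobBmaxPlus_tBmax :
    IsUnit (((algebraMap (BmaxPlus F p) (Bmax F p)).comp (frobBmaxPlus F p)) tBmax) := by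
  have h := congrArg (algebraMap (BmaxPlus F p) (Bmax F p)) (frobBmaxPlus_tBmax (F := F) (p := p))
  rw [map_mul, map_natCast, map_natCast] at h
  rw [RingHom.comp_apply, h]
  exact isUnit_natCast_bmax.mul isUnit_algebraMap_tBmax

/-- `σ t = χ(σ)·t` is a unit of `A_max[1/t]`. [folklore] -/
theorem isUnit_galBmaxPlus_tBmax (σ : absoluteGaloisGroup F) :
    IsUnit (((algebraMap (BmaxPlus F p) (Bmax F p)).comp (galBmaxPlus σ)) tBmax) := by
  have h := congrArg (algebraMap (BmaxPlus F p) (Bmax F p)) (galBmaxPlus_tBmax (F := F) (p := p) σ)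
  rw [map_mul] at h
  rw [RingHom.comp_apply, h]
  exact ((((GaloisRep.cyclotomicCharacter F p σ).isUnit.map zpToAinf).map
    (ainfToBmaxPlus F p)).map (algebraMap (BmaxPlus F p) (Bmax F p))).mul isUnit_algebraMap_tBmax

variable (F p) in
/-- **Frobenius on `B_max(F)`**, extending `φ` of `A_max`. [cite: FontaineAsterisque223III, Exp. II §2.3] -/
def frobBmax : Bmax F p →+* Bmax F p :=
  IsLocalization.Away.lift (S := Bmax F p) tBmax isUnit_frobBmaxPlus_tBmax

/-- **`σ ∈ Γ_F` on `B_max(F)`**, extending `galBmaxPlus σ`. [cite: FontaineAsterisque223III, Exp. II §2.3] -/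
def galBmax (σ : absoluteGaloisGroup F) : Bmax F p →+* Bmax F p :=
  IsLocalization.Away.lift (S := Bmax F p) tBmax (isUnit_galBmaxPlus_tBmax σ)

/-- `φ` extends `frobBmaxPlus`. [folklore] -/
theorem frobBmax_algebraMap (x : BmaxPlus F p) :
    frobBmax F p (algebraMap (BmaxPlus F p) (Bmax F p) x) =
      algebraMap (BmaxPlus F p) (Bmax F p) (frobBmaxPlus F p x) :=
  IsLocalization.Away.lift_eq _ _ _

/-- `galBmax σ` extends `galBmaxPlus σ`. [folklore] -/
theorem galBmax_algebraMap (σ : absoluteGaloisGroup F) (x : BmaxPlus F p) :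
    galBmax σ (algebraMap (BmaxPlus F p) (Bmax F p) x) =
      algebraMap (BmaxPlus F p) (Bmax F p) (galBmaxPlus σ x) :=
  IsLocalization.Away.lift_eq _ _ _

/-- **`φ` commutes with `Γ_F` on `B_max(F)`.** [cite: FontaineAsterisque223III, Exp. II §2.3] -/
theorem galBmax_comp_frobBmax (σ : absoluteGaloisGroup F) :
    (galBmax σ).comp (frobBmax F p) = (frobBmax F p).comp (galBmax σ) :=
  IsLocalization.ringHom_ext (Submonoid.powers (tBmax (F := F) (p := p))) <| by
    ext x; simp [galBmax_algebraMap, frobBmax_algebraMap, galBmaxPlus_frobBmaxPlus]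

variable (F p) in
/-- `ℤ_p → 𝔸_inf → A_max → A_max[1/t]`. [folklore] -/
def zpToBmax : ℤ_[p] →+* Bmax F p :=
  (algebraMap (BmaxPlus F p) (Bmax F p)).comp ((ainfToBmaxPlus F p).comp zpToAinf)

/-- Non-zero `p`-adic integers `u·p^k` become units in `A_max[1/t]`. [folklore] -/
theorem isUnit_zpToBmax {y : ℤ_[p]} (hy : y ≠ 0) : IsUnit (zpToBmax F p y) := by
  rw [PadicInt.unitCoeff_spec hy, map_mul, map_pow, map_natCast]
  exact ((PadicInt.unitCoeff hy).isUnit.map _).mul (isUnit_natCast_bmax.pow _)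

variable (F p) in
/-- **The `ℚ_p`-structure of `B_max(F)`**: `ℚ_p = Frac ℤ_p → A_max[1/t]`. [folklore] -/
def qpToBmax : ℚ_[p] →+* Bmax F p :=
  IsLocalization.lift (M := nonZeroDivisors ℤ_[p]) (S := ℚ_[p]) (g := zpToBmax F p)
    fun y => isUnit_zpToBmax (nonZeroDivisors.ne_zero y.2)

/-- `qpToBmax` extends `zpToBmax`. [folklore] -/
theorem qpToBmax_comp_algebraMap :
    (qpToBmax F p).comp (algebraMap ℤ_[p] ℚ_[p]) = zpToBmax F p :=
  IsLocalization.lift_comp _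

/-- The `ℚ_p`-algebra structure of `B_max(F)` (an instance on the new type only). [folklore] -/
instance algebraPadic : Algebra ℚ_[p] (Bmax F p) := (qpToBmax F p).toAlgebra

/-- `φ` fixes `ℤ_p`. [folklore] -/
theorem frobBmax_comp_zpToBmax : (frobBmax F p).comp (zpToBmax F p) = zpToBmax F p := by
  ext x
  simp only [RingHom.comp_apply, zpToBmax, frobBmax_algebraMap, frobBmaxPlus_ainfToBmaxPlus,
    frobenius_zpToAinf]

/-- `Γ_F` fixes `ℤ_p`. [folklore] -/
theorem galBmax_comp_zpToBmax (σ : absoluteGaloisGroup F) :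
    (galBmax σ).comp (zpToBmax F p) = zpToBmax F p := by
  ext x
  simp only [RingHom.comp_apply, zpToBmax, galBmax_algebraMap, galBmaxPlus_ainfToBmaxPlus,
    galAinf_zpToAinf]

/-- **`φ` is `ℚ_p`-linear.** [folklore] -/
theorem frobBmax_comp_qpToBmax : (frobBmax F p).comp (qpToBmax F p) = qpToBmax F p :=
  IsLocalization.ringHom_ext (nonZeroDivisors ℤ_[p]) <| by
    rw [RingHom.comp_assoc, qpToBmax_comp_algebraMap, frobBmax_comp_zpToBmax]

/-- **`Γ_F` acts `ℚ_p`-linearly.** [folklore] -/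
theorem galBmax_comp_qpToBmax (σ : absoluteGaloisGroup F) :
    (galBmax σ).comp (qpToBmax F p) = qpToBmax F p :=
  IsLocalization.ringHom_ext (nonZeroDivisors ℤ_[p]) <| by
    rw [RingHom.comp_assoc, qpToBmax_comp_algebraMap, galBmax_comp_zpToBmax]

variable (F p) in
/-- `φ` as a `ℚ_p`-algebra endomorphism of `B_max(F)`. [folklore] -/
def frobBmaxAlgHom : Bmax F p →ₐ[ℚ_[p]] Bmax F p :=
  ⟨frobBmax F p, fun r => RingHom.congr_fun frobBmax_comp_qpToBmax r⟩

/-- `σ ∈ Γ_F` as a `ℚ_p`-algebra automorphism of `B_max(F)` (that `σ ↦ galBmax σ` is a monoid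
homomorphism — from `galBmaxPlus_one`, `galBmaxPlus_mul` — is not needed for the invariants). [folklore] -/
def galBmaxAlgHom (σ : absoluteGaloisGroup F) : Bmax F p →ₐ[ℚ_[p]] Bmax F p :=
  ⟨galBmax σ, fun r => RingHom.congr_fun (galBmax_comp_qpToBmax σ) r⟩

/-- `φ` commutes with the action, `ℚ_p`-algebra form. [folklore] -/
theorem galBmaxAlgHom_comp_frobBmaxAlgHom (σ : absoluteGaloisGroup F) :
    (galBmaxAlgHom (F := F) (p := p) σ).comp (frobBmaxAlgHom F p) =
      (frobBmaxAlgHom F p).comp (galBmaxAlgHom σ) :=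
  AlgHom.ext fun x => RingHom.congr_fun (galBmax_comp_frobBmax (F := F) (p := p) σ) x

/-! ### §3 `D_cris` of a local framed representation over the constructed `B_max(F)` -/

/-- **`D_cris(ρ_v) := (ℚ̄_p^m ⊗_{ℚ_p} B_max(F))^{Γ_F}`** for a framed `ρ_v : Γ_F → GL_m(ℚ̄_p)`, over the
CONSTRUCTED `B_max(F) = A_max[1/t]`. [cite: FontaineAsterisque223III, Exp. III §1.3]
[cite: Colmez1998Annals, §III.2] -/
def Dcris {m : ℕ} (ρv : FramedRep (absoluteGaloisGroup F) (PadicAlgCl p) m) :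
    Submodule (PadicAlgCl p) ((Fin m → PadicAlgCl p) ⊗[ℚ_[p]] Bmax F p) :=
  invariants ρv (galBmaxAlgHom (F := F) (p := p))

/-- **`φ` on `D_cris(ρ_v)`** (`ℚ̄_p`-linear). [cite: FontaineAsterisque223III, Exp. III §1.3] -/
def phiDcris {m : ℕ} (ρv : FramedRep (absoluteGaloisGroup F) (PadicAlgCl p) m) :
    Dcris ρv →ₗ[PadicAlgCl p] Dcris ρv :=
  phiD ρv (galBmaxAlgHom (F := F) (p := p)) (frobBmaxAlgHom F p) galBmaxAlgHom_comp_frobBmaxAlgHom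

end Bmax

/-! ### §4 The clause and the re-scoped correspondence -/

section Clause

variable {n : ℕ} {K : Type} [Field K] [NumberField K] {hcpt : isCompact_glFiniteIntegralLevel n K}
  {ℓ : ℕ} [Fact ℓ.Prime]

/-- The predicted characteristic polynomial `∏_{a ∈ α} (X - ι⁻¹ a)` of a GEOMETRIC Frobenius at a place
with Satake parameter `α` (untwisted L-algebraic normalisation of the summit). [cite: BuzzardGeeLMS2014, Conj. 3.2.1] -/
def geomFrobPolyOfSatake (ι : PadicAlgCl ℓ ≃+* ℂ) (α : Multiset ℂ) : (PadicAlgCl ℓ)[X] :=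
  (α.map fun a => X - C (ι.symm a)).prod

/-- The summit's arithmetic-Frobenius polynomial at `m = 1` is the geometric one of the inverted
parameter: `arithFrobPolyOfSatake ι q 1 α = ∏ (X - (ι⁻¹ a)⁻¹)`. [folklore] -/
theorem geomFrobPolyOfSatake_eq (ι : PadicAlgCl ℓ ≃+* ℂ) (q : ℕ) (α : Multiset ℂ) :
    geomFrobPolyOfSatake ι (α.map Inv.inv) = arithFrobPolyOfSatake ι q 1 α := by
  simp [geomFrobPolyOfSatake, arithFrobPolyOfSatake, Multiset.map_map]

/-- **Crystalline Frobenius–Satake compatibility at a place `v ∣ ℓ`** (Buzzard–Gee Conj. 3.2.2, last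
clause, and the Frobenius half of its `p`-adic Hodge-type clause at unramified `v`, for `GL_n`): for
every Satake parameter `α` of `π` at `v` (so `π_v` unramified), `D_cris(ρ|Γ_{K_v})` — over the
constructed `B_max(K_v)`, for the canonical instance facts of `K_v` (`LocalField.charZero_adicCompletion`,
`not_isUnit_natCast_integerC`, `isAdicComplete_integerC_natCast`) — has a `ℚ̄_ℓ`-basis of size `n·f(v|ℓ)`
(i.e. `ρ|Γ_{K_v}` is crystalline) in which `charpoly (φ^{f(v|ℓ)}) = (∏_{a ∈ α} (X - ι⁻¹ a))^{f(v|ℓ)}`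
(Fontaine: `WD(D_cris)(Frob_geom) = φ^{f}`; `f(v|ℓ) = v.asIdeal.inertiaDeg ℤ`).  No reciprocity datum
occurs. [cite: BuzzardGeeLMS2014, Conj. 3.2.2] [cite: FontaineAsterisque223VIII, §2.3.7] -/
def CrystallineCompatibleAt (ι : PadicAlgCl ℓ ≃+* ℂ) (π : AutomorphicRepData (AutomorphyDatum.gl n K hcpt))
    (ρ : FramedGaloisRep K (PadicAlgCl ℓ) n) (v : HeightOneSpectrum (𝓞 K))
    (hv : ((ℓ : ℕ) : 𝓞 K) ∈ v.asIdeal) : Prop :=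
  haveI := LocalField.charZero_adicCompletion v
  haveI : Fact (¬ IsUnit ((ℓ : ℕ) : integerC (v.adicCompletion K))) :=
    ⟨not_isUnit_natCast_integerC (LocalField.valuation_adicCompletion_natCast_lt_one v ℓ hv)⟩
  haveI : IsAdicComplete (Ideal.span {((ℓ : ℕ) : integerC (v.adicCompletion K))})
      (integerC (v.adicCompletion K)) :=
    isAdicComplete_integerC_natCast (LocalField.valuation_adicCompletion_natCast_lt_one v ℓ hv)
  ∀ α : Multiset ℂ, π.HasSatakeParamAt v α →
    ∃ b : Module.Basis (Fin (n * v.asIdeal.inertiaDeg ℤ)) (PadicAlgCl ℓ) (Dcris (p := ℓ) (ρ.toLocal v)),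
      (LinearMap.toMatrix b b (phiDcris (p := ℓ) (ρ.toLocal v) ^ v.asIdeal.inertiaDeg ℤ)).charpoly =
        geomFrobPolyOfSatake ι α ^ v.asIdeal.inertiaDeg ℤ

/-- **`π` and `ρ` correspond, D2-cris form**: the R3⁺ clauses (`R3plus.CorrespondsR3plus`: Satake a.e.,
local–global compatibility at every `v ∤ ℓ`, Hodge–Tate weights at every `v ∣ ℓ`) and crystalline
Frobenius–Satake compatibility at every `v ∣ ℓ`. [cite: BuzzardGeeLMS2014, Conj. 3.2.1 and Conj. 3.2.2] -/
def CorrespondsD2Cris (𝓡 : ReciprocityData K) (ι : PadicAlgCl ℓ ≃+* ℂ)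
    (π : AutomorphicRepData (AutomorphyDatum.gl n K hcpt)) (ρ : FramedGaloisRep K (PadicAlgCl ℓ) n) : Prop :=
  R3plus.CorrespondsR3plus 𝓡 ι π ρ ∧
    ∀ (v : HeightOneSpectrum (𝓞 K)) (hv : ((ℓ : ℕ) : 𝓞 K) ∈ v.asIdeal), CrystallineCompatibleAt ι π ρ v hv

variable (n) in
/-- **(A) Automorphic → Galois, D2-cris form** — the summit's `AutomorphicToGalois` verbatim with
`Corresponds` replaced by `CorrespondsD2Cris`. [cite: BuzzardGeeLMS2014, Conj. 3.2.1 and Conj. 3.2.2] -/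
def AutomorphicToGaloisD2Cris (𝓡 : ReciprocityData K) (hcpt : isCompact_glFiniteIntegralLevel n K) : Prop :=
  ∀ π : CuspidalAutomorphicRepData n K hcpt, π.1.IsLAlgebraic →
    ∀ (ℓ : ℕ) [Fact ℓ.Prime] (ι : PadicAlgCl ℓ ≃+* ℂ),
      ∃ ρ : FramedGaloisRep K (PadicAlgCl ℓ) n,
        ρ.toGaloisRep.IsIrreducible ∧ IsGeometricFramed 𝓡 ρ ∧ CorrespondsD2Cris 𝓡 ι π.1 ρ ∧
          ∀ ρ' : FramedGaloisRep K (PadicAlgCl ℓ) n, CorrespondsD2Cris 𝓡 ι π.1 ρ' → IsConjugate ρ ρ'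

variable (n) in
/-- **(B) Galois → automorphic, D2-cris form** — the summit's `GaloisToAutomorphic` verbatim with
`Corresponds` replaced by `CorrespondsD2Cris`. [cite: FontaineMazurGeometric1995, Conj. 1]
[cite: BuzzardGeeLMS2014, Conj. 3.2.2] -/
def GaloisToAutomorphicD2Cris (𝓡 : ReciprocityData K) (hcpt : isCompact_glFiniteIntegralLevel n K) : Prop :=
  ∀ (ℓ : ℕ) [Fact ℓ.Prime] (ι : PadicAlgCl ℓ ≃+* ℂ) (ρ : FramedGaloisRep K (PadicAlgCl ℓ) n),
    ρ.toGaloisRep.IsIrreducible → IsGeometricFramed 𝓡 ρ →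
      ∃ π : CuspidalAutomorphicRepData n K hcpt, π.1.IsLAlgebraic ∧ CorrespondsD2Cris 𝓡 ι π.1 ρ

variable (n K) in
/-- **Global Langlands reciprocity for `GL_n` over `K`, D2-cris form**: (A) ∧ (B).
[cite: BuzzardGeeLMS2014, Conj. 3.2.2] [cite: FontaineMazurGeometric1995, Conj. 1] -/
def GlobalLanglandsCorrespondenceGLnD2Cris (𝓡 : ReciprocityData K)
    (hcpt : isCompact_glFiniteIntegralLevel n K) : Prop :=
  AutomorphicToGaloisD2Cris n 𝓡 hcpt ∧ GaloisToAutomorphicD2Cris n 𝓡 hcpt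

/-! ### §5 Certificates -/

/-- **Deligne–Serre uniqueness** (the shape of the tree's unconditional
`SoloBlind.isConjugate_of_eventually`, `Theorems/SoloBlindUniqueness`, Deligne–Serre Lemme 3.2): an
irreducible `ρ` is determined up to conjugacy by the characteristic polynomials of Frobenius at all but
finitely many unramified places.  Taken as a hypothesis here only to keep this file's imports built.
[cite: DeligneSerreASENS1974, Lemme 3.2 (p. 513)] -/
def DeligneSerreUniqueness (K : Type) [Field K] [NumberField K] (ℓ n : ℕ) [Fact ℓ.Prime] : Prop :=
  ∀ r r' : FramedGaloisRep K (PadicAlgCl ℓ) n, r.toGaloisRep.IsIrreducible →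
    (∀ᶠ v : HeightOneSpectrum (𝓞 K) in cofinite,
      r.IsUnramifiedAt v ∧ r'.IsUnramifiedAt v ∧
        ∃ P : Polynomial (PadicAlgCl ℓ), r.HasFrobCharpolyAt v P ∧ r'.HasFrobCharpolyAt v P) →
    IsConjugate r r'

end Clause

end D2Cris

/-- **`LanglandsD2Cris`** — the summit `Langlands` with its `v ∣ ℓ` local clause re-scoped to R3⁺ PLUS
crystalline Frobenius–Satake compatibility at every unramified `v ∣ ℓ`, typed over the constructed
`B_max(K_v) = A_max[1/t]` (no pinned datum): same outer quantifier shape as `Langlands`.  OPEN named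
conjecture stated in our theories (obligation node, `@[conjecture]`; not a Literature fact, not the
operator's Statement — a Theorems-side shadow of repair option D2-cris, between R3⁺ and D2-min).
[cite: BuzzardGeeLMS2014, Conj. 3.2.1 and Conj. 3.2.2] [cite: FontaineMazurGeometric1995, Conj. 1] -/
@[conjecture] def LanglandsD2Cris : Prop :=
  ∀ (F : Type) [Field F] [NumberField F],
    Nonempty (Summit.Langlands.ReciprocityData F) ∧
      ∀ (𝓡 : Summit.Langlands.ReciprocityData F) (n : ℕ), 0 < n →
        ∀ hcpt : isCompact_glFiniteIntegralLevel n F,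
          D2Cris.GlobalLanglandsCorrespondenceGLnD2Cris n F 𝓡 hcpt

/-- **The repair ladder: `LanglandsD2Cris → LanglandsR3plus`** (given Deligne–Serre uniqueness, which the
tree proves unconditionally as `SoloBlind.isConjugate_of_eventually`). [cite: DeligneSerreASENS1974, Lemme 3.2 (p. 513)] -/
theorem langlandsR3plus_of_langlandsD2Cris
    (hDS : ∀ (K : Type) [Field K] [NumberField K] (ℓ n : ℕ) [Fact ℓ.Prime],
      D2Cris.DeligneSerreUniqueness K ℓ n)
    (h : LanglandsD2Cris) : LanglandsR3plus := by
  intro F _ _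
  obtain ⟨hne, hall⟩ := h F
  refine ⟨hne, fun 𝓡 n hn hcpt => ?_⟩
  obtain ⟨hA, hB⟩ := hall 𝓡 n hn hcpt
  refine ⟨fun π hπ ℓ _ ι => ?_, fun ℓ _ ι ρ hirr hgeo => ?_⟩
  · -- (A): uniqueness over the LARGER class of R3⁺-corresponding `ρ'` by Deligne–Serre uniqueness
    obtain ⟨ρ, hirr, hgeo, hcor, _⟩ := hA π hπ ℓ ι
    exact ⟨ρ, hirr, hgeo, hcor.1, fun ρ' h' =>
      hDS F ℓ n ρ ρ' hirr (R3plus.eventually_frobCharpoly_of_correspondsR3plus hcor.1 h')⟩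
  · obtain ⟨π, hπ, hcor⟩ := hB ℓ ι ρ hirr hgeo
    exact ⟨π, hπ, hcor.1⟩

end Summit.Langlands.Langlands.Theorems

end
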